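import Literature.NumberTheory.EllipticCurves.SelmerPInftyRestriction
import Literature.NumberTheory.EllipticCurves.SelmerPInftyGaloisAction
import Literature.NumberTheory.EllipticCurves.QuadraticTwistSelmerPInfty
import HarnessLib

/-!
# The `Aut(K/ℚ)`-action on `H¹(K, E[p^∞])` in the subgroup model

For `E = W/ℚ`, a Galois quadratic number field `K` with non-trivial automorphism `σ₀`, and a
prime `p`: under the subgroup model `modelIso : H¹(Γ_K, E_K[p^∞]) ≃ H¹(galRange K, E[p^∞])` of
`SelmerPInftyRestriction`, the action of the chosen lift of `σ₀` on `H¹(K, E[p^∞])`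
(`IsLiftOfAut.conjH1Primary`, file `SelmerPInftyGaloisAction`) is the conjugation action
(`Literature.NumberTheory.EllipticCurves.conjH1`) of the transported lift
`liftToAbsGal K σ₀ ∈ Γ_ℚ` on `H¹(galRange K, E[p^∞])` (`modelIso_conjH1Primary`). Both are maps
of compatible pairs `Γ_K ⇉ galRange K`, `E_K[p^∞] ⇉ E[p^∞]`, which agree on the nose
(`resGal_conjGalCMH`, `primaryBaseChangeEquiv_smul_liftToAbsGal`). Everything here is proved;
bookkeeping for `Literature.NumberTheory.EllipticCurves.selmerCorank_baseChange_quadratic`. The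
number field `K` is taken in `Type`: the base field `ℚ` and `K` must live in one universe (the
tree's universe discipline for compatible pairs).

## References

* J.-P. Serre, *Galois Cohomology* (1997), I.§2.4–2.5. [SerreGaloisCohomology1997]
-/

noncomputable section

open scoped Classical

namespace Literature.NumberTheory.EllipticCurves

open GaloisRepresentations WeierstrassCurve

variable (K : Type) [Field K] [NumberField K] (W : WeierstrassCurve ℚ) (p : ℕ) (σ₀ : K ≃ₐ[ℚ] K)

/-- `e (c₀⁻¹ y) = τ₀⁻¹ (e y)` for the transported lift `c₀ = liftToAbsGal K σ₀` of `σ₀`, its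
lift `τ₀ = liftAut σ₀` to `K̄`, and `e : ℚ̄ ≃ K̄` the chosen isomorphism. [folklore] -/
theorem algEquivOfEmb_liftToAbsGal_symm_apply (y : AlgebraicClosure ℚ) :
    algEquivOfEmb K (closureEmb (K := ℚ) K)
        ((show AlgebraicClosure ℚ ≃ₐ[ℚ] AlgebraicClosure ℚ from liftToAbsGal (K := ℚ) K σ₀).symm y) =
      (liftAut σ₀).symm (algEquivOfEmb K (closureEmb (K := ℚ) K) y) := by
  apply (liftAut σ₀).injective
  refine ((algEquivOfEmb_liftToAbsGal_apply K σ₀ _).symm.trans ?_).trans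
    ((liftAut σ₀).apply_symm_apply _).symm
  exact congrArg (algEquivOfEmb K (closureEmb (K := ℚ) K))
    ((show AlgebraicClosure ℚ ≃ₐ[ℚ] AlgebraicClosure ℚ from
      liftToAbsGal (K := ℚ) K σ₀).apply_symm_apply y)

/-- **The Galois sides agree**: restricting `τ₀⁻¹ g τ₀ ∈ Γ_K` to `ℚ̄` gives `c₀⁻¹ (g|ℚ̄) c₀`.
[folklore] -/
theorem resGal_conjGalCMH (g : Field.absoluteGaloisGroup K) :
    resGal (K := ℚ) K ((isLiftOfAut_liftAut σ₀).conjGalCMH g) =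
      (liftToAbsGal (K := ℚ) K σ₀)⁻¹ * resGal (K := ℚ) K g * liftToAbsGal (K := ℚ) K σ₀ := by
  apply AlgEquiv.ext
  intro z
  apply (algEquivOfEmb K (closureEmb (K := ℚ) K)).injective
  refine (algEquivOfEmb_resGal_apply K _ z).trans ?_
  change (liftAut σ₀).symm ((show AlgebraicClosure K ≃ₐ[K] AlgebraicClosure K from g)
      (liftAut σ₀ (algEquivOfEmb K (closureEmb (K := ℚ) K) z))) =
    algEquivOfEmb K (closureEmb (K := ℚ) K)
      ((show AlgebraicClosure ℚ ≃ₐ[ℚ] AlgebraicClosure ℚ from liftToAbsGal (K := ℚ) K σ₀).symm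
        ((show AlgebraicClosure ℚ ≃ₐ[ℚ] AlgebraicClosure ℚ from resGal (K := ℚ) K g)
          ((show AlgebraicClosure ℚ ≃ₐ[ℚ] AlgebraicClosure ℚ from liftToAbsGal (K := ℚ) K σ₀) z)))
  refine Eq.trans ?_ (algEquivOfEmb_liftToAbsGal_symm_apply K σ₀ _).symm
  refine Eq.trans ?_ (congrArg (fun w ↦ (liftAut σ₀).symm w) (algEquivOfEmb_resGal_apply K g _).symm)
  exact congrArg (fun w ↦ (liftAut σ₀).symm ((show AlgebraicClosure K ≃ₐ[K] AlgebraicClosure K from g) w))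
    (algEquivOfEmb_liftToAbsGal_apply K σ₀ z).symm

variable {K} in
/-- The coefficient isomorphism `E(K̄) = E_K(K̄)` on an affine point. [folklore] -/
theorem localPointsEquivGeomPoints_some {x y : AlgebraicClosure K}
    (h : (W.baseChange (AlgebraicClosure K)).toAffine.Nonsingular x y) :
    ∃ h' : ((W.baseChange K).baseChange (AlgebraicClosure K)).toAffine.Nonsingular x y,
      localPointsEquivGeomPoints W K (Affine.Point.some x y h) = Affine.Point.some x y h' :=
  ⟨(baseChange_baseChange W K (AlgebraicClosure K)).symm ▸ h,
    Affine.Point.congrEquiv_some (baseChange_baseChange W K (AlgebraicClosure K)).symm h⟩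

variable {K} in
/-- **The coefficient sides agree**: moving a point of `E(ℚ̄)` by `c₀` and then to `E_K(K̄)` along
the chosen embedding is moving it to `E_K(K̄)` and then applying `τ₀` to the coordinates.
[folklore] -/
theorem localPointsEquivGeomPoints_pointsMap_smul (Q : geomPoints W) :
    localPointsEquivGeomPoints W K (pointsMap W K (liftToAbsGal (K := ℚ) K σ₀ • Q)) =
      (isLiftOfAut_liftAut σ₀).pointsMap W (localPointsEquivGeomPoints W K (pointsMap W K Q)) := by
  change (W.baseChange (AlgebraicClosure ℚ)).toAffine.Point at Q
  rcases Q with _ | ⟨x, y, h⟩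
  · change localPointsEquivGeomPoints W K (pointsMap W K 0) =
      (isLiftOfAut_liftAut σ₀).pointsMap W (localPointsEquivGeomPoints W K (pointsMap W K 0))
    simp only [map_zero]
  · -- both sides are affine points; compute them
    have hcx : (W.baseChange (AlgebraicClosure ℚ)).toAffine.Nonsingular
        ((show AlgebraicClosure ℚ ≃ₐ[ℚ] AlgebraicClosure ℚ from liftToAbsGal (K := ℚ) K σ₀) x)
        ((show AlgebraicClosure ℚ ≃ₐ[ℚ] AlgebraicClosure ℚ from liftToAbsGal (K := ℚ) K σ₀) y) :=
      (WeierstrassCurve.Affine.baseChange_nonsingular (W := W.toAffine)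
        (f := ((show AlgebraicClosure ℚ ≃ₐ[ℚ] AlgebraicClosure ℚ from
          liftToAbsGal (K := ℚ) K σ₀) : AlgebraicClosure ℚ →ₐ[ℚ] AlgebraicClosure ℚ))
        (AlgEquiv.injective _) x y).mpr h
    have hι : ∀ {a b : AlgebraicClosure ℚ}, (W.baseChange (AlgebraicClosure ℚ)).toAffine.Nonsingular a b →
        (W.baseChange (AlgebraicClosure K)).toAffine.Nonsingular (closureEmb (K := ℚ) K a)
          (closureEmb (K := ℚ) K b) := fun hab ↦
      (WeierstrassCurve.Affine.baseChange_nonsingular (W := W.toAffine)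
        (f := closureEmb (K := ℚ) K) (closureEmb (K := ℚ) K).injective _ _).mpr hab
    obtain ⟨h2, e2⟩ := localPointsEquivGeomPoints_some W (K := K) (hι hcx)
    obtain ⟨h4, e4⟩ := localPointsEquivGeomPoints_some W (K := K) (hι h)
    obtain ⟨h5, e5⟩ := (isLiftOfAut_liftAut σ₀).pointsMap_some W h4
    have e5' : (isLiftOfAut_liftAut σ₀).pointsMap W (Affine.Point.some _ _ h4) =
        Affine.Point.some _ _ h5 := e5
    change localPointsEquivGeomPoints W K (Affine.Point.some _ _ (hι hcx)) =
      (isLiftOfAut_liftAut σ₀).pointsMap W (localPointsEquivGeomPoints W K (Affine.Point.some _ _ (hι h)))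
    rw [e2, e4, e5']
    exact Affine.Point.some_eq_some_of_eq (algEquivOfEmb_liftToAbsGal_apply K σ₀ x)
      (algEquivOfEmb_liftToAbsGal_apply K σ₀ y)

variable {K} in
/-- The coefficient sides agree on `E[p^∞]`: `τ₀ (ι P) = ι (c₀ • P)` for the coefficient
isomorphism `ι = primaryBaseChangeEquiv`. [folklore] -/
theorem primaryBaseChangeEquiv_smul_liftToAbsGal (P : geomPrimaryTorsion W p) :
    (isLiftOfAut_liftAut σ₀).primaryTorsionMap W p (primaryBaseChangeEquiv K W p P) =
      primaryBaseChangeEquiv K W p (liftToAbsGal (K := ℚ) K σ₀ • P) := by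
  apply Subtype.ext
  rw [IsLiftOfAut.coe_primaryTorsionMap, primaryBaseChangeEquiv_apply, primaryBaseChangeEquiv_apply,
    coe_primaryBaseChangeMap, coe_primaryBaseChangeMap, primaryComponent.coe_smul]
  exact (localPointsEquivGeomPoints_pointsMap_smul W σ₀ _).symm

/-- **The action in the subgroup model.** For `K` Galois quadratic with `σ₀ ≠ 1`:
`modelIso (τ₀_* s) = (c₀)_* (modelIso s)`, where `τ₀_* = conjH1Primary` is the action of the
chosen lift of `σ₀` on `H¹(K, E[p^∞])` and `(c₀)_* = conjH1 … (liftToAbsGal K σ₀)` is the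
conjugation action on `H¹(galRange K, E[p^∞])`. Serre, *Galois Cohomology*, I.§2.5. [folklore] -/
theorem modelIso_conjH1Primary [IsGalois ℚ K] (h2 : Module.finrank ℚ K = 2) (hσ₀ : σ₀ ≠ 1)
    (s : galH1Primary (W.baseChange K) p) :
    haveI := normal_galRange K h2 hσ₀
    modelIso K W p ((isLiftOfAut_liftAut σ₀).conjH1Primary W p s) =
      conjH1 (galRange (K := ℚ) K) (geomPrimaryTorsion W p) (liftToAbsGal (K := ℚ) K σ₀)
        (modelIso K W p s) := by
  haveI := normal_galRange K h2 hσ₀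
  have hG : ((isLiftOfAut_liftAut σ₀).conjGalCMH).comp (rangeToResGal (K := ℚ) K) =
      (rangeToResGal (K := ℚ) K).comp
        (subgroupConj (galRange (K := ℚ) K) (liftToAbsGal (K := ℚ) K σ₀)) := by
    apply ContinuousMonoidHom.ext
    intro n
    apply resGal_injective (K := ℚ) K
    change resGal (K := ℚ) K ((isLiftOfAut_liftAut σ₀).conjGalCMH (rangeToResGal (K := ℚ) K n)) =
      resGal (K := ℚ) K (rangeToResGal (K := ℚ) K
        (subgroupConj (galRange (K := ℚ) K) (liftToAbsGal (K := ℚ) K σ₀) n))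
    rw [resGal_conjGalCMH, resGal_rangeToResGal, resGal_rangeToResGal, subgroupConj_apply_coe]
  have hM : ((primaryBaseChangeEquiv K W p).symm.toAddMonoidHom).comp
        ((isLiftOfAut_liftAut σ₀).primaryTorsionMap W p) =
      (DistribSMul.toAddMonoidHom (geomPrimaryTorsion W p) (liftToAbsGal (K := ℚ) K σ₀)).comp
        (primaryBaseChangeEquiv K W p).symm.toAddMonoidHom := by
    refine AddMonoidHom.ext fun m ↦ ?_
    apply (primaryBaseChangeEquiv K W p).injective
    change primaryBaseChangeEquiv K W p ((primaryBaseChangeEquiv K W p).symm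
        ((isLiftOfAut_liftAut σ₀).primaryTorsionMap W p m)) =
      primaryBaseChangeEquiv K W p (liftToAbsGal (K := ℚ) K σ₀ • (primaryBaseChangeEquiv K W p).symm m)
    rw [AddEquiv.apply_symm_apply, ← primaryBaseChangeEquiv_smul_liftToAbsGal,
      AddEquiv.apply_symm_apply]
  rw [modelIso_apply, modelIso_apply, IsLiftOfAut.conjH1Primary, conjH1, resH1Hom_resH1Hom,
    resH1Hom_resH1Hom]
  exact congrFun (congrArg DFunLike.coe (resH1Hom_congr hG hM _ _)) s

end Literature.NumberTheory.EllipticCurves
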